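import Literature.Probability.RandomPlanarGeometry.SAWIrreducibleBridgeCrossings
import HarnessLib

/-!
# The extremal irreducible bridges: length exactly `3A` forces the staple height profile `0,1,…,A,A,A−1,…,1,1,2,…,A`

Topic `Literature/Probability/RandomPlanarGeometry` (continues `SAWIrreducibleBridgeThreeSpan.lean`: `3A ≤ k` for an irreducible
`k`-step bridge of span `A ≥ 2` — Madras–Slade §4.2, p. 94).

THE EQUALITY CASE. If `k = 3A` (`A ≥ 2`), the counting in the three-span lemma is tight: the gap `{0,1}` is crossed once, every
internal gap exactly three times, and the only non-vertical steps are the two transverse steps flanking the single run of down-steps;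
self-avoidance (`±e₁` then `∓e₁` revisits a site) makes every vertical run monotone, and irreducibility (no renewal time) forces the
first transverse step to happen at the TOP height `A`. Hence the height profile is forced:
`h(t) = t` for `t ≤ A`, `h(t) = 2A + 1 − t` for `A < t ≤ 2A`, `h(t) = t − 2A` for `2A < t ≤ 3A` — the «staple» `U^A T D^{A−1} T U^{A−1}`.
(The sequel in the pulled-walk chain counts them: `2d(2d−1)` per span on `ℤ^{d+1}`, i.e. `N_{2A,3A} = 2d(2d−1)` for every `A ≥ 2`.)

## Contents (namespace `Literature.Probability.RandomPlanarGeometry.SAW.Zd`; theorems only, no data, no new definitions)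
private helpers (as in `SAWIrreducibleBridgeThreeSpan`), ★★ **`heights_of_length_eq_three_mul_span`** (the forced profile, `ℤ` heights;
in particular the steps at times `A` and `2A` are the only transverse ones). Every dimension `d ≥ 1`. Lane «pcv-sawmu» (a-p3 g16, 2026-08-24). [cite: MadrasSlade1993, §4.2, remark after Theorem 4.2.4 (p. 94)]
-/

noncomputable section

open Finset Literature.Probability.LatticeModels SimpleGraph
open scoped BigOperators

namespace Literature.Probability.RandomPlanarGeometry.SAW.Zd

variable {d : ℕ} [NeZero d]

/-! ### Discrete intermediate-value steps (copies of the private helpers of `SAWIrreducibleBridgeThreeSpan`) -/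

/-- First up-crossing of the gap `{g, g+1}` after `t₀`, for a `±1`-Lipschitz integer sequence. [folklore] -/
private theorem upcrossExt {h : ℕ → ℤ} {k : ℕ} (hstep : ∀ t, t < k → |h (t + 1) - h t| ≤ 1)
    {t₀ s₁ : ℕ} {g : ℤ} (h01 : t₀ ≤ s₁) (hs₁ : s₁ ≤ k) (hlo : h t₀ ≤ g) (hhi : g + 1 ≤ h s₁) :
    ∃ t, t₀ ≤ t ∧ t < s₁ ∧ h t = g ∧ h (t + 1) = g + 1 := by
  classical
  have hex : ∃ s, t₀ ≤ s ∧ s ≤ s₁ ∧ g + 1 ≤ h s := ⟨s₁, h01, le_rfl, hhi⟩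
  obtain ⟨s, ⟨hs0, hss₁, hsg⟩, hmin⟩ : ∃ s, (t₀ ≤ s ∧ s ≤ s₁ ∧ g + 1 ≤ h s) ∧
      ∀ u, u < s → ¬ (t₀ ≤ u ∧ u ≤ s₁ ∧ g + 1 ≤ h u) :=
    ⟨Nat.find hex, Nat.find_spec hex, fun u hu => Nat.find_min hex hu⟩
  have hst₀ : s ≠ t₀ := by
    rintro rfl
    omega
  obtain ⟨t, rfl⟩ : ∃ t, s = t + 1 := ⟨s - 1, by omega⟩
  have ht : h t ≤ g := by
    have := hmin t (Nat.lt_succ_self t)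
    simp only [not_and, not_le] at this
    have := this (by omega) (by omega)
    omega
  have hs := hstep t (by omega)
  rw [abs_le] at hs
  exact ⟨t, by omega, by omega, by omega, by omega⟩

/-- First down-crossing of the gap `{g, g+1}` after `t₀`, for a `±1`-Lipschitz integer sequence. [folklore] -/
private theorem downcrossExt {h : ℕ → ℤ} {k : ℕ} (hstep : ∀ t, t < k → |h (t + 1) - h t| ≤ 1)
    {t₀ s₁ : ℕ} {g : ℤ} (h01 : t₀ ≤ s₁) (hs₁ : s₁ ≤ k) (hhi : g + 1 ≤ h t₀) (hlo : h s₁ ≤ g) :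
    ∃ t, t₀ ≤ t ∧ t < s₁ ∧ h t = g + 1 ∧ h (t + 1) = g := by
  classical
  have hex : ∃ s, t₀ ≤ s ∧ s ≤ s₁ ∧ h s ≤ g := ⟨s₁, h01, le_rfl, hlo⟩
  obtain ⟨s, ⟨hs0, hss₁, hsg⟩, hmin⟩ : ∃ s, (t₀ ≤ s ∧ s ≤ s₁ ∧ h s ≤ g) ∧
      ∀ u, u < s → ¬ (t₀ ≤ u ∧ u ≤ s₁ ∧ h u ≤ g) :=
    ⟨Nat.find hex, Nat.find_spec hex, fun u hu => Nat.find_min hex hu⟩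
  have hst₀ : s ≠ t₀ := by
    rintro rfl
    omega
  obtain ⟨t, rfl⟩ : ∃ t, s = t + 1 := ⟨s - 1, by omega⟩
  have ht : g + 1 ≤ h t := by
    have := hmin t (Nat.lt_succ_self t)
    simp only [not_and, not_le] at this
    have := this (by omega) (by omega)
    omega
  have hs := hstep t (by omega)
  rw [abs_le] at hs
  exact ⟨t, by omega, by omega, by omega, by omega⟩

/-! ### Vertical unit steps and the two revisit lemmas -/

/-- A lattice step that raises the first coordinate is `+e₁`. [cite: MadrasSlade1993, Definition 1.2.4] -/
private theorem eq_add_e_of_adj_up_ext {x z : Site d} (ha : (zdGraph d).Adj x z) (h0 : z 0 = x 0 + 1) :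
    z = x + Pi.single 0 1 := by
  rw [zdGraph_adj_iff] at ha
  obtain ⟨i, hi | hi⟩ := ha
  · by_cases hi0 : i = 0
    · subst hi0; exact hi
    · have hc := congrFun hi 0
      rw [Pi.add_apply, Pi.single_eq_of_ne (Ne.symm hi0)] at hc
      omega
  · have hc := congrFun hi 0
    rw [Pi.add_apply] at hc
    by_cases hi0 : i = 0
    · subst hi0; rw [Pi.single_eq_same] at hc; omega
    · rw [Pi.single_eq_of_ne (Ne.symm hi0)] at hc; omega

/-- A lattice step that lowers the first coordinate is `−e₁`. [cite: MadrasSlade1993, Definition 1.2.4] -/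
private theorem eq_sub_e_of_adj_down_ext {x z : Site d} (ha : (zdGraph d).Adj x z) (h0 : z 0 = x 0 - 1) :
    z = x - Pi.single 0 1 := by
  rw [zdGraph_adj_iff] at ha
  obtain ⟨i, hi | hi⟩ := ha
  · have hc := congrFun hi 0
    rw [Pi.add_apply] at hc
    by_cases hi0 : i = 0
    · subst hi0; rw [Pi.single_eq_same] at hc; omega
    · rw [Pi.single_eq_of_ne (Ne.symm hi0)] at hc; omega
  · by_cases hi0 : i = 0
    · subst hi0; rw [hi]; simp
    · have hc := congrFun hi 0
      rw [Pi.add_apply, Pi.single_eq_of_ne (Ne.symm hi0)] at hc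
      omega

/-- `+e₁` followed by `−e₁` returns to the start. [cite: MadrasSlade1993, Definition 1.2.4] -/
private theorem eq_of_adj_up_down_ext {x y z : Site d} (hxy : (zdGraph d).Adj x y) (hyz : (zdGraph d).Adj y z)
    (h1 : y 0 = x 0 + 1) (h2 : z 0 = y 0 - 1) : z = x := by
  rw [eq_sub_e_of_adj_down_ext hyz h2, eq_add_e_of_adj_up_ext hxy h1, add_sub_cancel_right]

/-- `−e₁` followed by `+e₁` returns to the start. [cite: MadrasSlade1993, Definition 1.2.4] -/
private theorem eq_of_adj_down_up_ext {x y z : Site d} (hxy : (zdGraph d).Adj x y) (hyz : (zdGraph d).Adj y z)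
    (h1 : y 0 = x 0 - 1) (h2 : z 0 = y 0 + 1) : z = x := by
  rw [eq_add_e_of_adj_up_ext hyz h2, eq_sub_e_of_adj_down_ext hxy h1, sub_add_cancel]

/-! ### The theorem -/

/-- ★★ **The extremal profile.** An irreducible `k`-step bridge `ω` on `ℤ^d` with span `A = ω₁(k) ≥ 2` and `k = 3A` has the staple height
profile: `ω₁(t) = t` (`t ≤ A`), `= 2A + 1 − t` (`A < t ≤ 2A`), `= t − 2A` (`2A < t ≤ 3A`).
[cite: MadrasSlade1993, §4.2, remark after Theorem 4.2.4 (p. 94)] -/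
theorem heights_of_length_eq_three_mul_span {k : ℕ} {ω : ℕ → Site d}
    (hω : ω ∈ irreducibleBridges d k) (hA2 : 2 ≤ (ω k 0).toNat) (hk : (k : ℤ) = 3 * ω k 0) :
    ∀ t, t ≤ k → ω t 0 = if (t : ℤ) ≤ ω k 0 then (t : ℤ) else if (t : ℤ) ≤ 2 * ω k 0 then 2 * ω k 0 + 1 - t else (t : ℤ) - 2 * ω k 0 := by
  classical
  obtain ⟨hb, hk1, hbr, hirr⟩ := mem_irreducibleBridges.1 hω
  obtain ⟨hωs, -⟩ := mem_bridges.1 hb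
  obtain ⟨hω0, -, hadj, hinj⟩ := mem_saws.1 hωs
  -- heights
  set h : ℕ → ℤ := fun t => ω t 0 with hh
  have h0 : h 0 = 0 := by simp only [hh, hω0]; rfl
  have hstep : ∀ t, t < k → |h (t + 1) - h t| ≤ 1 := fun t ht => abs_sub_le_one_of_adj (hadj t ht) 0
  have hpos : ∀ i, 1 ≤ i → i ≤ k → 0 < h i ∧ h i ≤ h k := fun i hi1 hi2 => by
    have := hbr i hi1 hi2
    rw [hω0] at this
    exact this
  set A : ℤ := h k with hA
  have hA2' : 2 ≤ A := by
    have : ((ω k 0).toNat : ℤ) = ω k 0 := Int.toNat_of_nonneg (by have := (hpos k hk1 le_rfl).1; omega)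
    have h2 : (2 : ℤ) ≤ ((ω k 0).toNat : ℤ) := by exact_mod_cast hA2
    rw [this] at h2
    exact h2
  have h1 : h 1 = 1 := by
    have := (hpos 1 le_rfl hk1).1
    have hs := hstep 0 hk1
    rw [zero_add, abs_le] at hs
    omega
  -- no step pair up-down or down-up (self-avoidance)
  have hmem : ∀ i : ℕ, i ≤ k → i ∈ {j : ℕ | j ≤ k} := fun i hi => hi
  have no_ud : ∀ t, t + 2 ≤ k → h (t + 1) = h t + 1 → h (t + 2) = h (t + 1) - 1 → False := by
    intro t ht hu hd'
    have he : ω (t + 2) = ω t := eq_of_adj_up_down_ext (hadj t (by omega)) (hadj (t + 1) (by omega)) hu hd'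
    have := hinj (hmem (t + 2) ht) (hmem t (by omega)) he
    omega
  have no_du : ∀ t, t + 2 ≤ k → h (t + 1) = h t - 1 → h (t + 2) = h (t + 1) + 1 → False := by
    intro t ht hd' hu
    have he : ω (t + 2) = ω t := eq_of_adj_down_up_ext (hadj t (by omega)) (hadj (t + 1) (by omega)) hd' hu
    have := hinj (hmem (t + 2) ht) (hmem t (by omega)) he
    omega
  -- crossing times of the gap `{g, g+1}`
  set C : ℤ → Finset ℕ := fun g => (range k).filter fun t =>
    (h t = g ∧ h (t + 1) = g + 1) ∨ (h t = g + 1 ∧ h (t + 1) = g) with hC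
  have hmemC : ∀ {g : ℤ} {t : ℕ}, t ∈ C g ↔ t < k ∧ ((h t = g ∧ h (t + 1) = g + 1) ∨ (h t = g + 1 ∧ h (t + 1) = g)) := by
    intro g t
    simp only [hC, Finset.mem_filter, Finset.mem_range]
  have hdisj : ∀ g g' : ℤ, g ≠ g' → Disjoint (C g) (C g') := by
    intro g g' hne
    rw [Finset.disjoint_left]
    intro t ht ht'
    rw [hmemC] at ht ht'
    omega
  -- gap `0` is crossed at time `0`
  have hC0 : 1 ≤ (C 0).card := by
    have : 0 ∈ C 0 := by rw [hmemC]; exact ⟨hk1, Or.inl ⟨h0, by rw [h1]; norm_num⟩⟩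
    exact Finset.card_pos.2 ⟨0, this⟩
  -- an internal gap is crossed up, then down, then up again
  have hcross3 : ∀ g : ℤ, 1 ≤ g → g + 1 ≤ A →
      ∃ t₁ td t₂ : ℕ, t₁ < td ∧ td < t₂ ∧ t₂ < k ∧ h t₁ = g ∧ h (t₁ + 1) = g + 1 ∧ h td = g + 1 ∧ h (td + 1) = g ∧
        h t₂ = g ∧ h (t₂ + 1) = g + 1 := by
    intro g hg1 hgA
    -- first up-crossing, staying `≤ g` before it: use the minimal time of height `≥ g + 1`
    have hex : ∃ s, g + 1 ≤ h s ∧ s ≤ k := ⟨k, hgA, le_rfl⟩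
    obtain ⟨s₀, ⟨hs₀g, hs₀k⟩, hs₀min⟩ : ∃ s, (g + 1 ≤ h s ∧ s ≤ k) ∧ ∀ u, u < s → ¬ (g + 1 ≤ h u ∧ u ≤ k) :=
      ⟨Nat.find hex, Nat.find_spec hex, fun u hu => Nat.find_min hex hu⟩
    have hs₀0 : s₀ ≠ 0 := by rintro rfl; rw [h0] at hs₀g; omega
    obtain ⟨t₁, rfl⟩ : ∃ t, s₀ = t + 1 := ⟨s₀ - 1, by omega⟩
    have hbelow : ∀ u, u ≤ t₁ → h u ≤ g := by
      intro u hu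
      have := hs₀min u (by omega)
      simp only [not_and, not_le] at this
      by_contra hcon
      exact absurd (this (by omega)) (by omega)
    have ht₁g : h t₁ = g := by
      have hs := hstep t₁ (by omega)
      rw [abs_le] at hs
      have := hbelow t₁ le_rfl
      omega
    have ht₁g1 : h (t₁ + 1) = g + 1 := by
      have hs := hstep t₁ (by omega)
      rw [abs_le] at hs
      omega
    have ht₁1 : 1 ≤ t₁ := by
      by_contra h00
      have : t₁ = 0 := by omega
      rw [this, h0] at ht₁g
      omega
    have ht₁k : t₁ < k := by omega
    -- the walk comes back to height `≤ g` after `t₁`, else `t₁` is a renewal time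
    have hback : ∃ s, t₁ + 1 ≤ s ∧ s ≤ k ∧ h s ≤ g := by
      by_contra hno
      simp only [not_exists, not_and, not_le] at hno
      refine hirr t₁ ht₁1 (by omega) ⟨ht₁k.le, ?_, ?_⟩
      · intro i hi1 hi2
        refine ⟨(hpos i hi1 (by omega)).1 |> fun h' => by rw [hω0]; exact h', ?_⟩
        show h i ≤ h t₁
        rw [ht₁g]; exact hbelow i hi2
      · intro j hj1 hj2
        refine ⟨?_, ?_⟩
        · show h (t₁ + 0) < h (t₁ + j)
          rw [add_zero, ht₁g]
          have := hno (t₁ + j) (by omega) (by omega)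
          omega
        · show h (t₁ + j) ≤ h (t₁ + (k - t₁))
          rw [show t₁ + (k - t₁) = k by omega]
          exact (hpos (t₁ + j) (by omega) (by omega)).2
    obtain ⟨s, hs1, hsk, hsg⟩ := hback
    obtain ⟨td, htd1, htds, htdg1, htdg⟩ :=
      downcrossExt (g := g) (t₀ := t₁ + 1) (s₁ := s) hstep hs1 hsk (by rw [ht₁g1]) hsg
    obtain ⟨t₂, ht₂1, ht₂k, ht₂g, ht₂g1⟩ :=
      upcrossExt (g := g) (t₀ := td + 1) (s₁ := k) hstep (show td + 1 ≤ k by omega) le_rfl (by rw [htdg]) hgA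
    exact ⟨t₁, td, t₂, by omega, by omega, ht₂k, ht₁g, ht₁g1, htdg1, htdg, ht₂g, ht₂g1⟩
  have hC3 : ∀ g : ℤ, 1 ≤ g → g + 1 ≤ A → 3 ≤ (C g).card := by
    intro g hg1 hgA
    obtain ⟨t₁, td, t₂, h12, h23, ht₂k, ht₁g, ht₁g1, htdg1, htdg, ht₂g, ht₂g1⟩ := hcross3 g hg1 hgA
    have hsub : ({t₁, td, t₂} : Finset ℕ) ⊆ C g := by
      intro t ht
      simp only [Finset.mem_insert, Finset.mem_singleton] at ht
      rw [hmemC]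
      rcases ht with rfl | rfl | rfl
      · exact ⟨by omega, Or.inl ⟨ht₁g, ht₁g1⟩⟩
      · exact ⟨by omega, Or.inr ⟨htdg1, htdg⟩⟩
      · exact ⟨ht₂k, Or.inl ⟨ht₂g, ht₂g1⟩⟩
    have hcard : ({t₁, td, t₂} : Finset ℕ).card = 3 := by
      rw [Finset.card_eq_three]
      exact ⟨t₁, td, t₂, by omega, by omega, by omega, rfl⟩
    calc 3 = ({t₁, td, t₂} : Finset ℕ).card := hcard.symm
      _ ≤ (C g).card := Finset.card_le_card hsub
  -- the down-steps; the first and the last one are flanked by transverse steps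
  set D : Finset ℕ := (range k).filter fun t => h (t + 1) = h t - 1 with hD
  have hmemD : ∀ {t : ℕ}, t ∈ D ↔ t < k ∧ h (t + 1) = h t - 1 := by
    intro t; simp only [hD, Finset.mem_filter, Finset.mem_range]
  have hDne : D.Nonempty := by
    obtain ⟨t₁, td, t₂, -, h23, ht₂k, -, -, htdg1, htdg, -, -⟩ := hcross3 1 le_rfl (by omega)
    exact ⟨td, hmemD.2 ⟨by omega, by rw [htdg, htdg1]; ring⟩⟩
  set tm := D.min' hDne with htm
  set tM := D.max' hDne with htM
  have htmD : tm ∈ D := Finset.min'_mem D hDne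
  have htMD : tM ∈ D := Finset.max'_mem D hDne
  obtain ⟨htmk, htmd⟩ := hmemD.1 htmD
  obtain ⟨htMk, htMd⟩ := hmemD.1 htMD
  -- `tm ≥ 1` (step `0` is up) and the step before `tm` is transverse
  have htm1 : 1 ≤ tm := by
    by_contra h00
    have : tm = 0 := by omega
    rw [this, zero_add, h1, h0] at htmd
    omega
  obtain ⟨τ₁, hτ₁⟩ : ∃ τ, tm = τ + 1 := ⟨tm - 1, by omega⟩
  have hτ₁flat : h (τ₁ + 1) = h τ₁ := by
    have hs := hstep τ₁ (by omega)
    rw [abs_le] at hs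
    rcases lt_trichotomy (h (τ₁ + 1)) (h τ₁) with hlt | heq | hgt
    · -- step `τ₁` would be a down-step earlier than `tm`
      have hmem' : τ₁ ∈ D := hmemD.2 ⟨by omega, by omega⟩
      have := Finset.min'_le D τ₁ hmem'
      rw [← htm] at this
      omega
    · exact heq
    · -- up then down: a revisited site
      exact (no_ud τ₁ (by omega) (by omega) (by rw [show τ₁ + 2 = tm + 1 by omega, show τ₁ + 1 = tm by omega]; exact htmd)).elim
  -- `tM ≤ k - 2` (the last step of a bridge is not down) and the step after `tM` is transverse
  have htMk2 : tM + 2 ≤ k := by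
    by_contra hcon
    have : tM + 1 = k := by omega
    have hle : h tM ≤ h k := (hpos tM (by
      by_contra h00
      have h00' : tM = 0 := by omega
      rw [h00', zero_add, h1, h0] at htMd; omega) htMk.le).2
    rw [← this] at hle
    omega
  have hτ₂flat : h (tM + 1 + 1) = h (tM + 1) := by
    have hs := hstep (tM + 1) (by omega)
    rw [abs_le] at hs
    rcases lt_trichotomy (h (tM + 1 + 1)) (h (tM + 1)) with hlt | heq | hgt
    · have hmem' : tM + 1 ∈ D := hmemD.2 ⟨by omega, by omega⟩
      have := Finset.le_max' D (tM + 1) hmem'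
      rw [← htM] at this
      omega
    · exact heq
    · exact (no_du tM htMk2 htMd (by rw [show tM + 2 = tM + 1 + 1 from rfl]; omega)).elim
  -- the two transverse times
  set T : Finset ℕ := {τ₁, tM + 1} with hT
  have hτlt : τ₁ < tM + 1 := by
    have := Finset.min'_le D tM htMD
    rw [← htm] at this
    omega
  have hTcard : T.card = 2 := by
    rw [hT, Finset.card_pair (by omega)]
  have hTsub : T ⊆ range k := by
    intro t ht
    rw [hT, Finset.mem_insert, Finset.mem_singleton] at ht
    rw [Finset.mem_range]
    rcases ht with rfl | rfl <;> omega
  have hTdisj : ∀ g : ℤ, Disjoint (C g) T := by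
    intro g
    rw [Finset.disjoint_right]
    intro t ht htC
    rw [hT, Finset.mem_insert, Finset.mem_singleton] at ht
    rw [hmemC] at htC
    rcases ht with rfl | rfl
    · rw [hτ₁flat] at htC; omega
    · rw [hτ₂flat] at htC; omega
  -- count: distinct gaps are crossed at distinct times `< k`, none of them in `T`
  obtain ⟨M, hM⟩ : ∃ M : ℕ, A.toNat = M + 1 := ⟨A.toNat - 1, by omega⟩
  set U : Finset ℕ := (range (M + 1)).biUnion fun i : ℕ => C (i : ℤ) with hU'
  have hU : U ⊆ range k := by
    intro t ht
    obtain ⟨i, -, hi⟩ := Finset.mem_biUnion.1 ht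
    rw [hmemC] at hi
    exact Finset.mem_range.2 hi.1
  have hUT : Disjoint U T := by
    rw [hU', Finset.disjoint_biUnion_left]
    intro i _
    exact hTdisj _
  have hsumU : U.card = ∑ i ∈ range (M + 1), (C (i : ℤ)).card := by
    rw [hU', Finset.card_biUnion]
    intro i _ j _ hij
    exact hdisj _ _ (by exact_mod_cast hij)
  have hsum : ∑ i ∈ range (M + 1), (C (i : ℤ)).card + 2 ≤ k := by
    have h' : (U ∪ T).card ≤ (range k).card := Finset.card_le_card (Finset.union_subset hU hTsub)
    rw [Finset.card_union_of_disjoint hUT, hsumU, hTcard, Finset.card_range] at h'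
    exact h'
  have hlow : 1 + 3 * M ≤ ∑ i ∈ range (M + 1), (C (i : ℤ)).card := by
    rw [Finset.sum_range_succ']
    have h3 : 3 * M ≤ ∑ i ∈ range M, (C ((i + 1 : ℕ) : ℤ)).card := by
      calc 3 * M = ∑ i ∈ range M, 3 := by simp [mul_comm]
        _ ≤ ∑ i ∈ range M, (C ((i + 1 : ℕ) : ℤ)).card :=
            Finset.sum_le_sum fun i hi => by
              have hi' := Finset.mem_range.1 hi
              exact hC3 _ (by push_cast; omega) (by push_cast; omega)
    have h1' : 1 ≤ (C ((0 : ℕ) : ℤ)).card := by simpa using hC0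
    omega
  -- EQUALITY: `k = 3A` ⇒ every time other than `τ₁`, `tM + 1` is a crossing time, hence a vertical step
  have hM' : (ω k 0).toNat = M + 1 := hM
  have hAM : A = (M : ℤ) + 1 := by
    have : ((ω k 0).toNat : ℤ) = ω k 0 := Int.toNat_of_nonneg (by omega)
    rw [hM'] at this; push_cast at this; rw [hA]; linarith
  have hkM : k = 3 * M + 3 := by
    have hk' : (k : ℤ) = 3 * A := hk
    rw [hAM] at hk'
    omega
  have hfull : U ∪ T = range k := by
    apply Finset.eq_of_subset_of_card_le (Finset.union_subset hU hTsub)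
    rw [Finset.card_union_of_disjoint hUT, hsumU, hTcard, Finset.card_range]
    omega
  have hvert : ∀ t, t < k → t ≠ τ₁ → t ≠ tM + 1 → h (t + 1) = h t + 1 ∨ h (t + 1) = h t - 1 := by
    intro t htk ht1 ht2
    have htU : t ∈ U ∪ T := by rw [hfull]; exact Finset.mem_range.2 htk
    rw [Finset.mem_union] at htU
    rcases htU with htU | htT
    · obtain ⟨i, -, hi⟩ := Finset.mem_biUnion.1 htU
      rw [hmemC] at hi
      rcases hi.2 with ⟨h1', h2'⟩ | ⟨h1', h2'⟩
      · left; omega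
      · right; omega
    · rw [hT, Finset.mem_insert, Finset.mem_singleton] at htT
      rcases htT with rfl | rfl
      · exact absurd rfl ht1
      · exact absurd rfl ht2
  -- the two transverse times and the down-run
  set τ₂ := tM + 1 with hτ₂def
  have hτ₁k : τ₁ < k := by omega
  have hτ₂k : τ₂ < k := by omega
  -- run 1: all steps before `τ₁` are up, so `h t = t` for `t ≤ τ₁`
  have hrun1 : ∀ t, t ≤ τ₁ → h t = t := by
    intro t
    induction t with
    | zero => intro _; rw [h0]; simp
    | succ t ih =>
      intro ht
      have hprev := ih (by omega)
      have hne1 : t ≠ τ₁ := by omega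
      have hne2 : t ≠ tM + 1 := by omega
      rcases hvert t (by omega) hne1 hne2 with hup | hdown
      · rw [hup, hprev]; push_cast; ring
      · -- a down-step before the first down-step `tm = τ₁ + 1`
        exfalso
        have hmem' : t ∈ D := hmemD.2 ⟨by omega, by omega⟩
        have := Finset.min'_le D t hmem'
        rw [← htm] at this
        omega
  -- run 2: the steps `τ₁ + 1, …, tM` are down
  have hrun2 : ∀ j, τ₁ + 1 + j ≤ tM → h (τ₁ + 1 + j + 1) = h (τ₁ + 1 + j) - 1 := by
    intro j
    induction j with
    | zero => intro _; rw [add_zero, ← hτ₁]; exact htmd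
    | succ j ih =>
      intro hj
      have hprev := ih (by omega)
      have hne1 : τ₁ + 1 + (j + 1) ≠ τ₁ := by omega
      have hne2 : τ₁ + 1 + (j + 1) ≠ tM + 1 := by omega
      rcases hvert (τ₁ + 1 + (j + 1)) (by omega) hne1 hne2 with hup | hdown
      · have hup' : h (τ₁ + 1 + j + 2) = h (τ₁ + 1 + j + 1) + 1 := by
          rw [show τ₁ + 1 + j + 2 = τ₁ + 1 + (j + 1) + 1 by ring, show τ₁ + 1 + j + 1 = τ₁ + 1 + (j + 1) by ring]; exact hup
        exact (no_du (τ₁ + 1 + j) (by omega) hprev hup').elim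
      · exact hdown
  have hrun2' : ∀ j, τ₁ + 1 + j ≤ tM + 1 → h (τ₁ + 1 + j) = (τ₁ : ℤ) - j := by
    intro j
    induction j with
    | zero => intro _; rw [add_zero, hτ₁flat, hrun1 τ₁ le_rfl]; simp
    | succ j ih =>
      intro hj
      rw [show τ₁ + 1 + (j + 1) = τ₁ + 1 + j + 1 by ring, hrun2 j (by omega), ih (by omega)]
      push_cast; ring
  -- run 3: the steps after `τ₂` are up
  have hrun3 : ∀ j, τ₂ + 1 + j < k → h (τ₂ + 1 + j + 1) = h (τ₂ + 1 + j) + 1 := by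
    intro j
    induction j with
    | zero =>
      intro hj
      rw [add_zero]
      rcases hvert (τ₂ + 1) (by omega) (by omega) (by omega) with hup | hdown
      · exact hup
      · exfalso
        have hmem' : τ₂ + 1 ∈ D := hmemD.2 ⟨by omega, hdown⟩
        have := Finset.le_max' D (τ₂ + 1) hmem'
        rw [← htM] at this
        omega
    | succ j ih =>
      intro hj
      have hprev := ih (by omega)
      rcases hvert (τ₂ + 1 + (j + 1)) (by omega) (by omega) (by omega) with hup | hdown
      · exact hup
      · have hdown' : h (τ₂ + 1 + j + 2) = h (τ₂ + 1 + j + 1) - 1 := by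
          rw [show τ₂ + 1 + j + 2 = τ₂ + 1 + (j + 1) + 1 by ring, show τ₂ + 1 + j + 1 = τ₂ + 1 + (j + 1) by ring]; exact hdown
        exact (no_ud (τ₂ + 1 + j) (by omega) hprev hdown').elim
  have hrun3' : ∀ j, τ₂ + 1 + j ≤ k → h (τ₂ + 1 + j) = h τ₂ + j := by
    intro j
    induction j with
    | zero => intro _; rw [add_zero, hτ₂flat]; simp
    | succ j ih =>
      intro hj
      rw [show τ₂ + 1 + (j + 1) = τ₂ + 1 + j + 1 by ring, hrun3 j (by omega), ih (by omega)]
      push_cast; ring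
  -- parameters: `a = τ₁`, `δ = tM − τ₁` down-steps, `r = k − τ₂ − 1` final up-steps
  have hτ₂h : h τ₂ = (τ₁ : ℤ) - (tM - τ₁ : ℕ) := by
    have := hrun2' (tM - τ₁) (by omega)
    rwa [show τ₁ + 1 + (tM - τ₁) = τ₂ by omega] at this
  have hkh : h k = h τ₂ + (k - τ₂ - 1 : ℕ) := by
    have := hrun3' (k - τ₂ - 1) (by omega)
    rwa [show τ₂ + 1 + (k - τ₂ - 1) = k by omega] at this
  have hτ₂pos : 1 ≤ h τ₂ := by
    have := (hpos τ₂ (by omega) hτ₂k.le).1; omega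
  have ha_le : (τ₁ : ℤ) ≤ A := by
    have := (hpos τ₁ (by omega) hτ₁k.le).2
    rw [hrun1 τ₁ le_rfl] at this; exact this
  -- irreducibility forces `τ₁ = A`: otherwise the final ascent passes height `τ₁` at a renewal time
  have ha_eq : (τ₁ : ℤ) = A := by
    by_contra hne
    have hlt : (τ₁ : ℤ) < A := lt_of_le_of_ne ha_le hne
    -- the time `t* = τ₂ + 1 + δ'` of the final ascent at height `τ₁`, `δ' = τ₁ − h τ₂`
    obtain ⟨δ', hδ'⟩ : ∃ δ' : ℕ, (δ' : ℤ) = (τ₁ : ℤ) - h τ₂ := ⟨(τ₁ : ℤ) - h τ₂ |>.toNat, Int.toNat_of_nonneg (by rw [hτ₂h]; omega)⟩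
    have htstar_lt : τ₂ + 1 + δ' < k := by
      have h1' : h k = A := hA.symm ▸ rfl
      zify at *
      omega
    have htstar_h : h (τ₂ + 1 + δ') = τ₁ := by rw [hrun3' δ' htstar_lt.le, hδ']; ring
    refine hirr (τ₂ + 1 + δ') (by omega) (by omega) ⟨htstar_lt.le, ?_, ?_⟩
    · intro i hi1 hi2
      refine ⟨(hpos i hi1 (by omega)).1 |> fun h' => by rw [hω0]; exact h', ?_⟩
      show h i ≤ h (τ₂ + 1 + δ')
      rw [htstar_h]
      -- heights up to `t*`: at most `τ₁` before `τ₂ + 1`, and ascending below `τ₁` afterwards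
      rcases Nat.lt_or_ge i (τ₁ + 1) with hi' | hi'
      · rw [hrun1 i (by omega)]; exact_mod_cast (by omega : i ≤ τ₁)
      rcases Nat.lt_or_ge i (τ₂ + 1) with hi'' | hi''
      · have := hrun2' (i - τ₁ - 1) (by omega)
        rw [show τ₁ + 1 + (i - τ₁ - 1) = i by omega] at this
        rw [this]; omega
      · have := hrun3' (i - τ₂ - 1) (by omega)
        rw [show τ₂ + 1 + (i - τ₂ - 1) = i by omega] at this
        rw [this]
        have : ((i - τ₂ - 1 : ℕ) : ℤ) ≤ δ' := by exact_mod_cast (by omega : i - τ₂ - 1 ≤ δ')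
        omega
    · intro j hj1 hj2
      refine ⟨?_, ?_⟩
      · show h (τ₂ + 1 + δ' + 0) < h (τ₂ + 1 + δ' + j)
        rw [add_zero, htstar_h]
        have := hrun3' (δ' + j) (by omega)
        rw [show τ₂ + 1 + (δ' + j) = τ₂ + 1 + δ' + j by ring] at this
        rw [this]; push_cast; omega
      · show h (τ₂ + 1 + δ' + j) ≤ h (τ₂ + 1 + δ' + (k - (τ₂ + 1 + δ')))
        rw [show τ₂ + 1 + δ' + (k - (τ₂ + 1 + δ')) = k by omega]
        exact (hpos _ (by omega) (by omega)).2
  -- now the arithmetic: `τ₁ = A`, `h τ₂ ≥ 1`, `h k = A` ⇒ `tM = 2A − 1`, `τ₂ = 2A`, `h τ₂ = 1`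
  have hA' : h k = A := rfl
  intro t ht
  show h t = _
  rw [show ω k 0 = A from rfl]
  have hτ₁A : (τ₁ : ℤ) = A := ha_eq
  have key : (tM : ℤ) = 2 * A - 1 := by
    zify at *
    push_cast [Nat.cast_sub (show τ₂ + 1 ≤ k by omega), Nat.cast_sub (show τ₁ ≤ tM by omega)] at hkh hτ₂h
    omega
  rcases Nat.lt_or_ge t (τ₁ + 1) with h1t | h1t
  · rw [hrun1 t (by omega), if_pos (by omega)]
  rcases Nat.lt_or_ge t (τ₂ + 1) with h2t | h2t
  · have := hrun2' (t - τ₁ - 1) (by omega)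
    rw [show τ₁ + 1 + (t - τ₁ - 1) = t by omega] at this
    rw [this, if_neg (by omega), if_pos (by omega)]
    omega
  · have := hrun3' (t - τ₂ - 1) (by omega)
    rw [show τ₂ + 1 + (t - τ₂ - 1) = t by omega] at this
    rw [this, hτ₂h, if_neg (by omega), if_neg (by omega)]
    push_cast [Nat.cast_sub (show τ₂ + 1 ≤ t by omega), Nat.cast_sub (show τ₁ ≤ tM by omega)]
    omega

end Literature.Probability.RandomPlanarGeometry.SAW.Zd

end
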